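import Literature.AlgebraicGeometry.Motives.SmoothProperModelTopFormFrame
import Literature.AlgebraicGeometry.Motives.RationalTopFormFrames
import Literature.AlgebraicGeometry.Smoothening.ChartUniformizerPrime
import Literature.RingTheory.Localization.UnitsAwayPrimeElement
import HarnessLib

/-!
# The chart coefficient of a generic-fibre frame on a smooth model is `ϖᴹ · u / ϖᴺ`

Topic `Literature/NumberTheory/DiophantineGeometry` (proofs only; no definitions, no named facts).
Let `R` be a discrete valuation ring with uniformizer `ϖ` and fraction field `K`, and `𝒳 → Spec R`
a smooth `R`-scheme with geometrically irreducible fibres (`𝒳` integral). Let `θ = (f₀, B₀)` be a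
rational top form over `R` on `𝒳` (a rational function `f₀ ∈ K(𝒳)` and a basis `B₀` of
`Ω[K(𝒳)⁄R]`) which is a **frame at every point of the generic fibre** `𝒳_K` (the output of
★ `exists_topForm_frame_genericFibre_of_grpObj`, Bosch–Lütkebohmert–Raynaud §4.2 Prop. 1–2), and
let `V = Spec B` be an affine chart of `𝒳` MEETING THE SPECIAL FIBRE, with exact relative
coordinates `d y₁, …, d yₙ` (a basis of `Ω[B⁄R]`, function-field basis `B_V`). Then the chart
coefficient `f = f₀ · B_V.det B₀ ∈ K(𝒳) = Frac B` of `θ` satisfies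

  `f · ϖᴺ = ϖᴹ · u` for some unit `u ∈ Bˣ` and `N, M ∈ ℕ`

(`exists_pow_mul_units_of_frame`): `θ` generates `Ωⁿ` over the generic fibre `V_K = Spec B[1/ϖ]`
of the chart (★ `inter_preimage_range_specGenericPoint_eq_basicOpen`, BLR §2.3), so `f` is a unit
of `B[1/ϖ] = Γ(𝒳, D(ϖ|_V))` (★ `forall_isUnitAt_iff_exists_units`, Görtz–Wedhorn I Prop. 3.29 (3)),
and `ϖ|_V` is a prime element of the noetherian domain `B` (★
`prime_algebraMap_sections_of_mem_specialFibre`, EGA IV₄ (17.5.1), BLR §2.3 Prop. 4), whence the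
shape `ϖᴹ · u / ϖᴺ` (★ `exists_eq_pow_mul_unit_div_pow_of_isUnit`). This is the «unit extraction
on the chart» half of the statement «the relative Jacobian `Δ` of the birational group law is a
unit» (Edixhoven–Romagny Thm. 6.3 / BLR §4.3–4.4), in the exact shape of the hypothesis `hf` of
★ `isUnit_of_cocycle_identity`. Cell `hodgecm-mathlib`, road W of `r₀` ((W0) S7a).

## Sources

* S. Bosch, W. Lütkebohmert, M. Raynaud, *Néron Models*, Springer 1990, §2.3 (generic fibre of a
  chart, Prop. 4), §4.2 Prop. 1–2, §4.3. [BLRNeronModels1990]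
* U. Görtz, T. Wedhorn, *Algebraic Geometry I*, 2nd ed. 2020, Prop. 3.29 (3), (3.4)–(3.5).
  [GortzWedhorn2020]
* B. Edixhoven, M. Romagny, *Group schemes out of birational group laws, Néron models*, 2012,
  Thm. 6.3. [EdixhovenRomagny2012]
-/

noncomputable section

universe u

namespace Literature.NumberTheory.DiophantineGeometry

open CategoryTheory Limits _root_.AlgebraicGeometry Opposite TopologicalSpace
open Literature.AlgebraicGeometry.Motives Literature.AlgebraicGeometry.Motives.RatFn
open Literature.AlgebraicGeometry.Smoothening Literature.NumberTheory.EllipticCurves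
open Literature.RingTheory.Localization

variable {R : Type u} [CommRing R] [IsDomain R] [IsDiscreteValuationRing R]
  (K : Type u) [Field K] [Algebra R K] [IsFractionRing R K]
  (𝒳 : Over (Spec (.of R))) [IsIntegral 𝒳.left] (n : ℕ)

/-! ### The chart algebra and the function field -/

omit [IsDomain R] [IsDiscreteValuationRing R] in
/-- For the chart algebra structure `R → Γ(𝒳, V)` of an open `V` and an `R`-algebra structure on
`K(𝒳)` equal to `stalkHom 𝒳 η`, the composite `R → Γ(𝒳, V) → K(𝒳)` is the structure map of `K(𝒳)`
(Görtz–Wedhorn I, (3.4)–(3.5)). [cite: GortzWedhorn2020, (3.4)–(3.5)] -/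
theorem algebraMap_functionField_eq_comp_chart {V : 𝒳.left.Opens} [Nonempty V]
    [Algebra R 𝒳.left.functionField]
    (hRL : algebraMap R 𝒳.left.functionField = stalkHom 𝒳 (genericPoint 𝒳.left)) :
    letI := ((Scheme.ΓSpecIso (.of R)).inv ≫ 𝒳.hom.appLE ⊤ V le_top).hom.toAlgebra
    algebraMap R 𝒳.left.functionField =
      (algebraMap Γ(𝒳.left, V) 𝒳.left.functionField).comp (algebraMap R Γ(𝒳.left, V)) := by
  letI := ((Scheme.ΓSpecIso (.of R)).inv ≫ 𝒳.hom.appLE ⊤ V le_top).hom.toAlgebra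
  obtain ⟨⟨v₀, hv₀⟩⟩ := ‹Nonempty V›
  have hη : genericPoint 𝒳.left ∈ V :=
    ((genericPoint_spec 𝒳.left).mem_open_set_iff V.isOpen).2 ⟨v₀, Set.mem_univ _, hv₀⟩
  rw [hRL, ← germ_comp_appLE_eq_stalkHom 𝒳 V (genericPoint 𝒳.left) hη]
  rfl

/-! ### Unit extraction on a chart meeting the special fibre -/

omit [IsDomain R] [IsDiscreteValuationRing R] [IsIntegral 𝒳.left] in
/-- The ring of sections of an affine open of a smooth `R`-scheme is a smooth `R`-algebra for the
chart algebra structure (Mathlib `HasRingHomProperty.appLE`). [folklore] -/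
private theorem smooth_chartAlgebra [Smooth 𝒳.hom] {V : 𝒳.left.Opens} (hV : IsAffineOpen V) :
    ((Scheme.ΓSpecIso (.of R)).inv ≫ 𝒳.hom.appLE ⊤ V le_top).hom.Smooth := by
  have h1 : (𝒳.hom.appLE ⊤ V le_top).hom.Smooth :=
    HasRingHomProperty.appLE (P := @Smooth) 𝒳.hom inferInstance ⟨⊤, isAffineOpen_top _⟩ ⟨V, hV⟩
      le_top
  rw [CommRingCat.hom_comp]
  exact RingHom.Smooth.comp
    (RingHom.Smooth.of_bijective (Scheme.ΓSpecIso (.of R)).commRingCatIsoToRingEquiv.symm.bijective) h1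

/-- **The chart coefficient of a generic-fibre frame is `ϖᴹ · u / ϖᴺ`.** Let `𝒳 → Spec R` be smooth
with geometrically irreducible fibres over a dvr `R` (uniformizer `ϖ`, fraction field `K`), `θ = (f₀, B₀)`
a rational top form over `R` on `𝒳` which is a frame at every point over the generic point of `Spec R`
(hypothesis `hθ`, the shape of ★ `exists_topForm_frame_genericFibre_of_grpObj`), and `V` an affine
chart containing a point `x` of the special fibre, with exact relative coordinates `d yᵢ` (basis `bV`
of `Ω[Γ(𝒳, V)⁄R]`, function-field basis `B_V` with `B_V i = d yᵢ`). Then the chart coefficient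
`f₀ · B_V.det B₀` is of the form `ϖᴹ · u / ϖᴺ` with `u ∈ Γ(𝒳, V)ˣ`: it is a unit at every point of
the generic fibre `D(ϖ|_V)` of the chart (BLR §2.3, §4.2 Prop. 1–2), hence a unit of
`Γ(𝒳, D(ϖ|_V)) = Γ(𝒳, V)[1/ϖ]` (Görtz–Wedhorn I Prop. 3.29 (3)), and `ϖ|_V` is a prime element of the
noetherian domain `Γ(𝒳, V)` (BLR §2.3 Prop. 4). The conclusion is literally the hypothesis `hf` of
★ `isUnit_of_cocycle_identity` («unit extraction on the chart», Edixhoven–Romagny Thm. 6.3).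
[cite: BLRNeronModels1990, §4.2 Prop. 1–2 and §2.3 Prop. 4] -/
theorem exists_pow_mul_units_of_frame [Smooth 𝒳.hom] [GeometricallyIrreducible 𝒳.hom]
    {ϖ : R} (hϖ : Irreducible ϖ) {V : 𝒳.left.Opens} (hV : IsAffineOpen V) {x : 𝒳.left}
    (hxV : x ∈ V) (hx : 𝒳.hom.base x = IsLocalRing.closedPoint R)
    [Algebra R 𝒳.left.functionField] {y : Fin n → Γ(𝒳.left, V)}
    (bV : letI := ((Scheme.ΓSpecIso (.of R)).inv ≫ 𝒳.hom.appLE ⊤ V le_top).hom.toAlgebra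
      Module.Basis (Fin n) Γ(𝒳.left, V) Ω[Γ(𝒳.left, V)⁄R])
    (hbV : letI := ((Scheme.ΓSpecIso (.of R)).inv ≫ 𝒳.hom.appLE ⊤ V le_top).hom.toAlgebra
      ∀ i, bV i = KaehlerDifferential.D R _ (y i))
    (f₀ : 𝒳.left.functionField)
    (B₀ : Module.Basis (Fin n) 𝒳.left.functionField Ω[𝒳.left.functionField⁄R])
    {BV : Module.Basis (Fin n) 𝒳.left.functionField Ω[𝒳.left.functionField⁄R]}
    (hBV : haveI : Nonempty V := ⟨⟨x, hxV⟩⟩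
      ∀ i, BV i = KaehlerDifferential.D R _ (algebraMap Γ(𝒳.left, V) 𝒳.left.functionField (y i)))
    (hθ : ∀ (p : 𝒳.left) (_ : 𝒳.hom.base p ∈ Set.range (specGenericPoint R K).base)
        (z : Fin n → 𝒳.left.presheaf.stalk p)
        (b : letI := (stalkHom 𝒳 p).toAlgebra
          Module.Basis (Fin n) (𝒳.left.presheaf.stalk p) Ω[𝒳.left.presheaf.stalk p⁄R])
        (_ : letI := (stalkHom 𝒳 p).toAlgebra; ∀ i, b i = KaehlerDifferential.D R _ (z i))
        (B : Module.Basis (Fin n) 𝒳.left.functionField Ω[𝒳.left.functionField⁄R])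
        (_ : ∀ i, B i = KaehlerDifferential.D R _ (toFunctionField p (z i))),
        IsUnitAt p (f₀ * B.det B₀)) :
    haveI : Nonempty V := ⟨⟨x, hxV⟩⟩
    ∃ (u : Γ(𝒳.left, V)ˣ) (N M : ℕ),
      f₀ * BV.det B₀ *
          algebraMap Γ(𝒳.left, V) 𝒳.left.functionField
            (((Scheme.ΓSpecIso (.of R)).inv ≫ 𝒳.hom.appLE ⊤ V le_top).hom ϖ) ^ N =
        algebraMap Γ(𝒳.left, V) 𝒳.left.functionField
            (((Scheme.ΓSpecIso (.of R)).inv ≫ 𝒳.hom.appLE ⊤ V le_top).hom ϖ) ^ M *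
          algebraMap Γ(𝒳.left, V) 𝒳.left.functionField u := by
  classical
  haveI hVne : Nonempty V := ⟨⟨x, hxV⟩⟩
  letI alg : Algebra R Γ(𝒳.left, V) :=
    ((Scheme.ΓSpecIso (.of R)).inv ≫ 𝒳.hom.appLE ⊤ V le_top).hom.toAlgebra
  -- notation: the uniformizer on the chart, the chart coefficient
  set π : Γ(𝒳.left, V) := ((Scheme.ΓSpecIso (.of R)).inv ≫ 𝒳.hom.appLE ⊤ V le_top).hom ϖ with hπdef
  set f : 𝒳.left.functionField := f₀ * BV.det B₀ with hfdef
  have hη : genericPoint 𝒳.left ∈ V :=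
    ((genericPoint_spec 𝒳.left).mem_open_set_iff V.isOpen).2 ⟨x, Set.mem_univ _, hxV⟩
  -- ### `π` is a prime element of the noetherian domain `Γ(𝒳, V)`
  have hπ : Prime π := prime_algebraMap_sections_of_mem_specialFibre 𝒳 hϖ hV hxV hx
  haveI : Algebra.Smooth R Γ(𝒳.left, V) := smooth_chartAlgebra 𝒳 hV
  haveI : Algebra.FiniteType R Γ(𝒳.left, V) := inferInstance
  haveI : IsNoetherianRing Γ(𝒳.left, V) := Algebra.FiniteType.isNoetherianRing R Γ(𝒳.left, V)
  -- ### `f` is a unit at every point of the generic fibre `D(π)` of the chart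
  have hgen : ∀ p ∈ 𝒳.left.basicOpen π, IsUnitAt p f := by
    intro p hp
    have hp' : p ∈ (V : Set 𝒳.left) ∩ 𝒳.hom.base ⁻¹' Set.range (specGenericPoint R K).base := by
      rw [inter_preimage_range_specGenericPoint_eq_basicOpen K 𝒳 hϖ V]
      exact hp
    obtain ⟨hpV, hpgen⟩ := hp'
    letI : Algebra R (𝒳.left.presheaf.stalk p) := (stalkHom 𝒳 p).toAlgebra
    have halg : algebraMap R (𝒳.left.presheaf.stalk p) =
        (𝒳.left.presheaf.germ V p hpV).hom.comp (algebraMap R Γ(𝒳.left, V)) :=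
      (germ_comp_appLE_eq_stalkHom 𝒳 V p hpV).symm
    obtain ⟨b, hb⟩ := exists_basis_stalk_of_chart' n hV bV hbV hpV halg
    refine hθ p hpgen (fun i => 𝒳.left.presheaf.germ V p hpV (y i)) b hb BV fun i => ?_
    rw [hBV i, toFunctionField_germ]
    rfl
  -- ### hence `f` is a unit of `Γ(𝒳, D(π)) = Γ(𝒳, V)[1/π]`
  have hπ0 : π ≠ 0 := hπ.ne_zero
  have hηπ : genericPoint 𝒳.left ∈ 𝒳.left.basicOpen π := by
    rw [Scheme.mem_basicOpen (hx := hη)]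
    exact (isUnit_iff_ne_zero.2
      ((map_ne_zero_iff _ (germ_injective_of_isIntegral 𝒳.left (genericPoint 𝒳.left) hη)).2
        hπ0))
  haveI : Nonempty ↥(𝒳.left.basicOpen π) := ⟨⟨_, hηπ⟩⟩
  haveI : Nonempty ↥((𝒳.left.basicOpen π : 𝒳.left.Opens) : Scheme.{u}) :=
    ⟨(⟨_, hηπ⟩ : (𝒳.left.basicOpen π : 𝒳.left.Opens))⟩
  obtain ⟨u', hu'⟩ := (forall_isUnitAt_iff_exists_units (V := 𝒳.left.basicOpen π) f).1 hgen
  -- ### and is therefore `πᴹ · u / πᴺ` with `u ∈ Γ(𝒳, V)ˣ`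
  haveI : IsLocalization.Away π Γ(𝒳.left, 𝒳.left.basicOpen π) := hV.isLocalization_basicOpen π
  obtain ⟨M, N, u, hu⟩ :=
    exists_eq_pow_mul_unit_div_pow_of_isUnit hπ Γ(𝒳.left, 𝒳.left.basicOpen π) u'.isUnit
  have hres : ∀ s : Γ(𝒳.left, V),
      algebraMap Γ(𝒳.left, 𝒳.left.basicOpen π) 𝒳.left.functionField
          (algebraMap Γ(𝒳.left, V) Γ(𝒳.left, 𝒳.left.basicOpen π) s) =
        algebraMap Γ(𝒳.left, V) 𝒳.left.functionField s := fun s =>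
    TopCat.Presheaf.germ_res_apply 𝒳.left.presheaf _ _ _ _
  refine ⟨u, N, M, ?_⟩
  have h := congrArg (algebraMap Γ(𝒳.left, 𝒳.left.basicOpen π) 𝒳.left.functionField) hu
  simp only [map_mul, map_pow, hres, hu'] at h
  exact h

/-- **The chart coefficient of a generic-fibre frame is `ϖᴹ · u / ϖᴺ`, with the function-field basis
supplied**: as `exists_pow_mul_units_of_frame`, producing as well the basis `B_V` of `Ω[K(𝒳)⁄R]` with
`B_V i = d yᵢ` (★ `exists_basis_functionField_of_chart'`), for the `R`-algebra structure
`stalkHom 𝒳 η` on `K(𝒳)` (the form consumed by the assembly of «`Δ` is a unit»).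
[cite: BLRNeronModels1990, §4.2 Prop. 1–2 and §2.3 Prop. 4] -/
theorem exists_basis_pow_mul_units_of_frame [Smooth 𝒳.hom] [GeometricallyIrreducible 𝒳.hom]
    {ϖ : R} (hϖ : Irreducible ϖ) {V : 𝒳.left.Opens} (hV : IsAffineOpen V) {x : 𝒳.left}
    (hxV : x ∈ V) (hx : 𝒳.hom.base x = IsLocalRing.closedPoint R)
    [Algebra R 𝒳.left.functionField]
    (hRL : algebraMap R 𝒳.left.functionField = stalkHom 𝒳 (genericPoint 𝒳.left))
    {y : Fin n → Γ(𝒳.left, V)}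
    (bV : letI := ((Scheme.ΓSpecIso (.of R)).inv ≫ 𝒳.hom.appLE ⊤ V le_top).hom.toAlgebra
      Module.Basis (Fin n) Γ(𝒳.left, V) Ω[Γ(𝒳.left, V)⁄R])
    (hbV : letI := ((Scheme.ΓSpecIso (.of R)).inv ≫ 𝒳.hom.appLE ⊤ V le_top).hom.toAlgebra
      ∀ i, bV i = KaehlerDifferential.D R _ (y i))
    (f₀ : 𝒳.left.functionField)
    (B₀ : Module.Basis (Fin n) 𝒳.left.functionField Ω[𝒳.left.functionField⁄R])
    (hθ : ∀ (p : 𝒳.left) (_ : 𝒳.hom.base p ∈ Set.range (specGenericPoint R K).base)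
        (z : Fin n → 𝒳.left.presheaf.stalk p)
        (b : letI := (stalkHom 𝒳 p).toAlgebra
          Module.Basis (Fin n) (𝒳.left.presheaf.stalk p) Ω[𝒳.left.presheaf.stalk p⁄R])
        (_ : letI := (stalkHom 𝒳 p).toAlgebra; ∀ i, b i = KaehlerDifferential.D R _ (z i))
        (B : Module.Basis (Fin n) 𝒳.left.functionField Ω[𝒳.left.functionField⁄R])
        (_ : ∀ i, B i = KaehlerDifferential.D R _ (toFunctionField p (z i))),
        IsUnitAt p (f₀ * B.det B₀)) :
    haveI : Nonempty V := ⟨⟨x, hxV⟩⟩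
    ∃ (BV : Module.Basis (Fin n) 𝒳.left.functionField Ω[𝒳.left.functionField⁄R])
      (_ : ∀ i, BV i =
        KaehlerDifferential.D R _ (algebraMap Γ(𝒳.left, V) 𝒳.left.functionField (y i)))
      (u : Γ(𝒳.left, V)ˣ) (N M : ℕ),
      f₀ * BV.det B₀ *
          algebraMap Γ(𝒳.left, V) 𝒳.left.functionField
            (((Scheme.ΓSpecIso (.of R)).inv ≫ 𝒳.hom.appLE ⊤ V le_top).hom ϖ) ^ N =
        algebraMap Γ(𝒳.left, V) 𝒳.left.functionField
            (((Scheme.ΓSpecIso (.of R)).inv ≫ 𝒳.hom.appLE ⊤ V le_top).hom ϖ) ^ M *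
          algebraMap Γ(𝒳.left, V) 𝒳.left.functionField u := by
  haveI hVne : Nonempty V := ⟨⟨x, hxV⟩⟩
  letI alg : Algebra R Γ(𝒳.left, V) :=
    ((Scheme.ΓSpecIso (.of R)).inv ≫ 𝒳.hom.appLE ⊤ V le_top).hom.toAlgebra
  obtain ⟨BV, hBV⟩ := exists_basis_functionField_of_chart' n hV bV hbV
    (algebraMap_functionField_eq_comp_chart 𝒳 hRL)
  obtain ⟨u, N, M, h⟩ := exists_pow_mul_units_of_frame K 𝒳 n hϖ hV hxV hx bV hbV f₀ B₀ hBV hθ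
  exact ⟨BV, hBV, u, N, M, h⟩

end Literature.NumberTheory.DiophantineGeometry
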